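/-
Copyright (c) 2026 the pub-hodgecm-mathlib formalisation cell (harness21).  Prover seat hodgecm-mathlib-LH4-p07 (g11) (Track A «FOUR-FRAME» free hand routed by the
CHAIR VALVE to L1; LEAD F0P6-plan (g14) BATCH #108 (2) 2026-09-04T22:51:40Z «(K1a-♮) `K2LiuKindOneSingularTermPackage` statement-first»), Track B «K2-LIT»,
#184♮ = hLiu418 = stmt-HodgeConjecture-24832; line lead K2E5-p16 (g8), census `K2/K2E5-p16/g8/CENSUS-K1a-GK.K2E5-p16-g8.md` §3 (K1a-4); this seat's census
`F0/P3c/LH4/LH4-p07/g11/k1a/CENSUS-K1a-SingularTermPackage.LH4p07g11.md` §1 row `hEac` («NOT ★: the `∏'`-collapse lemma at this integrand»).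
THE K1 TAIL COLLAPSE: the restricted Euler product of (local K1 scalar) × (a factor equal to `1` off a finite set) is the K1 scalar of record times a FINITE product.
-/
import Summits.HodgeConjecture.HodgeConjecture.Theorems.K2LiuKindOneSingularScalarGL1   -- ★ p862613 (R90-C14-p02 (g0), (K1a-4) FILE 1): `hasProd_localScalarK1{,_cm}`
import HarnessLib

/-!
# Crux `HLiu418`, road `K2_Liu`, socket #41 KIND 1 a♮ — (K1a-4)′ THE K1 TAIL COLLAPSE `K2LiuKindOneSingularTailCollapse`:
# `∏'_{v ∉ T} [c¹_v(s) · P_v(s)] = ζ_F^T(2s) ∕ (ζ_F^T(2s+1)·L^T(2s+2, ε)) · ∏_{v ∈ D} P_v(s)` when `P_v = 1` off the finite set `D`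

Cell `hodgecm-mathlib`, crux item hLiu418 = `stmt-HodgeConjecture-24832`, route `HCCMUnconditional`; squad K2 ∕ K2Liu, LEAD F0P6-plan (g14), line lead K2E5-p16 (g8),
K1 desk F0P2-p11 (g2).  THEOREMS ONLY (no `def`, no instance, no notation, no named-fact hypothesis, no `sorry`, default heartbeats); lane
`--supports stmt-HodgeConjecture-24832 --as helper` (count-neutral).

WHY.  ★ G1 `K2LiuWhittakerDeltaEulerProduct.whittakerDelta_eq_mul_tprod_euler`, applied at the corner index `S♭ = E₁₁ σ♭` of a rank-one `S` (★ p862643 (K1a-1)), writes the singular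
Whittaker term as `HEAD_T(s) · ∏'_{v ∉ T} W°_v(s)`; the good-place value ★ p862724 (K1a-2)(2b) reads, after the `L(2s, ε)`, `L(2s+1, ε)` cancellation of the line lead's census §1,
`W°_v(s) = c¹_v(s) · P°_v(σ♭; s)` with the LOCAL K1 SCALAR `c¹_v(s) = (1 − q_v^{−(2s+1)})(1 − ε_v q_v^{−(2s+2)}) ∕ (1 − q_v^{−2s})` and the shell polynomial `P°_v = 1` unless
`ord_v σ♭ ≥ 1` — a FINITE set `D` of places.  ★ (K1a-4) FILE 2 `K2LiuRankOneSingularEulerContinued.exists_Eac_of_tail_scalarK1_cm` consumes the tail in the COLLAPSED form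
`W = HT · [ζ_F^T(2s) ∕ (ζ_F^T(2s+1)·L^T(2s+2, ε))] · ∏_{v∈D} P_v`; THIS FILE is the one-line bridge between the two shapes — the K1 sibling of ★ `K2LiuBigCellTailScalar.tprod_eq_scalar_of_forall_eq`
(KIND 0, no finite factor) — on the whole half-plane `Re s > ½` where ★ `hasProd_localScalarK1` converges (so in particular on ★ G1's domain `Re s > 1`).
* §1 (any number field `F`, unitary `ε`): **`hasProd_localScalarK1_mul`** — `HasProd (v ↦ c¹_v(s)·P v) (sc^S(s) · ∏_{v∈D} P v)` for `P : places → ℂ` equal to `1` off `S` outside the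
  finite `D ⊆ Sᶜ`; **`tprod_eq_scalarK1_mul_finsetProd_of_forall_eq`** — the `∏'` form for any family `I` that agrees pointwise with `c¹_v(s)·P v`; **`tprod_eq_scalarK1_of_forall_eq`**
  — the factor-free case (`I v = c¹_v(s)` ⇒ `∏' I = sc^S(s)`), the literal K1 twin of ★ `tprod_eq_scalar_of_forall_eq`; **`multipliable_scalarK1_mul`**.
* §2 the CM forms at the K2_Liu frame (`F = L⁺`, `ε = ε_{L∕L⁺} =` ★ `quadraticHeckeCharCM L`): **`tprod_eq_scalarK1_mul_finsetProd_of_forall_eq_cm`**, **`tprod_eq_scalarK1_of_forall_eq_cm`**.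
HONEST LABEL.  Helper lemmas (Euler-product bookkeeping), count-neutral; nothing here closes a socket: `HC_CM` is proved only modulo the 7 printed citations (2 remaining named
inputs: hLiu418 = `stmt-HodgeConjecture-24832`, h413 = `stmt-HodgeConjecture-24833`) until rung 0 closes.

## References
* [Tan1999] V. Tan, *Poles of Siegel Eisenstein series on U(n,n)*, Canad. J. Math. 51 (1999) 164–175: §3 (the unramified computation), §4 Prop. 4.8.
* [KudlaRallis1994] S. Kudla, S. Rallis, *A regularized Siegel–Weil formula: the first term identity*, Ann. of Math. 140 (1994): §2 (singular Fourier coefficients).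
* [Harris2007] M. Harris, *Cohomological automorphic forms on unitary groups, II* (2007): (1.3.4) p. 92 (the restricted Euler product of the local scalars).
-/

set_option autoImplicit false
set_option linter.dupNamespace false -- the mandated namespace repeats `HodgeConjecture.HodgeConjecture`

noncomputable section

open scoped NNReal
open Filter Topology Complex NumberField IsDedekindDomain
open Literature.NumberTheory.Automorphic Literature.NumberTheory.LFunctions Literature.NumberTheory.GaloisRepresentations
open Summit.HodgeConjecture.HodgeConjecture.Cruxes.HLiu418.K2LiuKindOneSingularScalarGL1

namespace Summit.HodgeConjecture.HodgeConjecture.Cruxes.HLiu418.K2LiuKindOneSingularTailCollapse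

/-! ## §1 Any number field `F`, unitary `ε` -/

section GL1

variable {F : Type} [Field F] [NumberField F] {ε : HeckeCharacter F}

omit [NumberField F] in
/-- **A FACTOR EQUAL TO `1` OFF A FINITE SET HAS A FINITE EULER PRODUCT.**  For `P : places → ℂ`, a finite `D` of places off `S`, and `P v = 1` for `v ∉ S`, `v ∉ D`:
`HasProd (v : {v ∉ S} ↦ P v) (∏_{v ∈ D} P v)` (★ `hasProd_prod_of_ne_finset_one` on `D` pulled into the subtype; `Finset.prod_subtype_of_mem`). [folklore] -/
theorem hasProd_factor_of_eq_one_off (S : Set (HeightOneSpectrum (𝓞 F))) (P : HeightOneSpectrum (𝓞 F) → ℂ)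
    (D : Finset (HeightOneSpectrum (𝓞 F))) (hDS : ∀ v ∈ D, v ∉ S) (hP : ∀ v, v ∉ S → v ∉ D → P v = 1) :
    HasProd (fun v : {v : HeightOneSpectrum (𝓞 F) // v ∉ S} => P v.1) (∏ v ∈ D, P v) := by
  classical
  have h1 : HasProd (fun v : {v : HeightOneSpectrum (𝓞 F) // v ∉ S} => P v.1)
      (∏ v ∈ D.subtype (fun v => v ∉ S), P v.1) :=
    hasProd_prod_of_ne_finset_one fun v hv => hP v.1 v.2 (fun hD => hv (Finset.mem_subtype.2 hD))
  rwa [Finset.prod_subtype_of_mem (fun v => P v) hDS] at h1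

/-- **THE K1 TAIL WITH A FINITE FACTOR, `HasProd` form (`Re s > ½`)**: `∏'_{v∉S} c¹_v(s)·P v` `HasProd`-converges to `[ζ_F^S(2s) ∕ (ζ_F^S(2s+1)·L^S(2s+2, ε))] · ∏_{v∈D} P v` when
`P = 1` off `S` outside the finite `D ⊆ Sᶜ` — ★ `hasProd_localScalarK1` times `hasProd_factor_of_eq_one_off` (`HasProd.mul`).
[cite: Tan1999, §3; §4 Prop. 4.8] [cite: Harris2007, (1.3.4) p. 92] -/
theorem hasProd_localScalarK1_mul (hε : ε.IsUnitary) (S : Set (HeightOneSpectrum (𝓞 F))) {s : ℂ} (hs : 1 / 2 < s.re)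
    (P : HeightOneSpectrum (𝓞 F) → ℂ) (D : Finset (HeightOneSpectrum (𝓞 F))) (hDS : ∀ v ∈ D, v ∉ S) (hP : ∀ v, v ∉ S → v ∉ D → P v = 1) :
    HasProd (fun v : {v : HeightOneSpectrum (𝓞 F) // v ∉ S} =>
        ((1 - (v.1.residueCard : ℂ) ^ (-(2 * s + 1))) * (1 - ε.valueAtUniformizer v.1 * (v.1.residueCard : ℂ) ^ (-(2 * s + 2)))) /
            (1 - (v.1.residueCard : ℂ) ^ (-(2 * s))) * P v.1)
      (partialStandardL S (fun _ => {1}) (2 * s) /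
          (partialStandardL S (fun _ => {1}) (2 * s + 1) * partialStandardL S (fun v => {ε.valueAtUniformizer v}) (2 * s + 2)) *
        ∏ v ∈ D, P v) :=
  (hasProd_localScalarK1 (S := S) hε hs).mul (hasProd_factor_of_eq_one_off S P D hDS hP)

/-- **Multipliability of the K1 tail with a finite factor** (`Re s > ½`). [cite: Tan1999, §3] -/
theorem multipliable_localScalarK1_mul (hε : ε.IsUnitary) (S : Set (HeightOneSpectrum (𝓞 F))) {s : ℂ} (hs : 1 / 2 < s.re)
    (P : HeightOneSpectrum (𝓞 F) → ℂ) (D : Finset (HeightOneSpectrum (𝓞 F))) (hDS : ∀ v ∈ D, v ∉ S) (hP : ∀ v, v ∉ S → v ∉ D → P v = 1) :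
    Multipliable (fun v : {v : HeightOneSpectrum (𝓞 F) // v ∉ S} =>
        ((1 - (v.1.residueCard : ℂ) ^ (-(2 * s + 1))) * (1 - ε.valueAtUniformizer v.1 * (v.1.residueCard : ℂ) ^ (-(2 * s + 2)))) /
            (1 - (v.1.residueCard : ℂ) ^ (-(2 * s))) * P v.1) :=
  (hasProd_localScalarK1_mul hε S hs P D hDS hP).multipliable

/-- **THE K1 TAIL COLLAPSE (`∏'` form, `Re s > ½`)**: a family `I` over the places off `S` that agrees pointwise with `c¹_v(s) · P v`, where `P = 1` off `S` outside the finite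
`D ⊆ Sᶜ`, has `∏'_{v∉S} I v = [ζ_F^S(2s) ∕ (ζ_F^S(2s+1)·L^S(2s+2, ε))] · ∏_{v∈D} P v` — the shape ★ (K1a-4) FILE 2 `exists_Eac_of_tail_scalarK1_cm`'s `htail` consumes, read off ★ G1's
restricted product.  The K1 sibling of ★ `K2LiuBigCellTailScalar.tprod_eq_scalar_of_forall_eq`. [cite: Tan1999, §3; §4 Prop. 4.8] [cite: KudlaRallis1994, §2] [cite: Harris2007, (1.3.4) p. 92] -/
theorem tprod_eq_scalarK1_mul_finsetProd_of_forall_eq (hε : ε.IsUnitary) (S : Set (HeightOneSpectrum (𝓞 F))) {s : ℂ} (hs : 1 / 2 < s.re)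
    (P : HeightOneSpectrum (𝓞 F) → ℂ) (D : Finset (HeightOneSpectrum (𝓞 F))) (hDS : ∀ v ∈ D, v ∉ S) (hP : ∀ v, v ∉ S → v ∉ D → P v = 1)
    (I : {v : HeightOneSpectrum (𝓞 F) // v ∉ S} → ℂ)
    (hI : ∀ v : {v : HeightOneSpectrum (𝓞 F) // v ∉ S},
      I v = ((1 - (v.1.residueCard : ℂ) ^ (-(2 * s + 1))) * (1 - ε.valueAtUniformizer v.1 * (v.1.residueCard : ℂ) ^ (-(2 * s + 2)))) /
            (1 - (v.1.residueCard : ℂ) ^ (-(2 * s))) * P v.1) :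
    ∏' v : {v : HeightOneSpectrum (𝓞 F) // v ∉ S}, I v =
      partialStandardL S (fun _ => {1}) (2 * s) /
          (partialStandardL S (fun _ => {1}) (2 * s + 1) * partialStandardL S (fun v => {ε.valueAtUniformizer v}) (2 * s + 2)) *
        ∏ v ∈ D, P v := by
  rw [show I = fun v : {v : HeightOneSpectrum (𝓞 F) // v ∉ S} =>
      ((1 - (v.1.residueCard : ℂ) ^ (-(2 * s + 1))) * (1 - ε.valueAtUniformizer v.1 * (v.1.residueCard : ℂ) ^ (-(2 * s + 2)))) /
            (1 - (v.1.residueCard : ℂ) ^ (-(2 * s))) * P v.1 from funext hI]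
  exact (hasProd_localScalarK1_mul hε S hs P D hDS hP).tprod_eq

/-- **THE K1 TAIL, NO FINITE FACTOR (`Re s > ½`)**: `I v = c¹_v(s)` pointwise ⇒ `∏'_{v∉S} I v = ζ_F^S(2s) ∕ (ζ_F^S(2s+1)·L^S(2s+2, ε))` — the literal K1 twin of ★
`K2LiuBigCellTailScalar.tprod_eq_scalar_of_forall_eq` (★ `hasProd_localScalarK1`). [cite: Tan1999, §4 Prop. 4.8] [cite: Harris2007, (1.3.4) p. 92] -/
theorem tprod_eq_scalarK1_of_forall_eq (hε : ε.IsUnitary) (S : Set (HeightOneSpectrum (𝓞 F))) {s : ℂ} (hs : 1 / 2 < s.re)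
    (I : {v : HeightOneSpectrum (𝓞 F) // v ∉ S} → ℂ)
    (hI : ∀ v : {v : HeightOneSpectrum (𝓞 F) // v ∉ S},
      I v = ((1 - (v.1.residueCard : ℂ) ^ (-(2 * s + 1))) * (1 - ε.valueAtUniformizer v.1 * (v.1.residueCard : ℂ) ^ (-(2 * s + 2)))) /
        (1 - (v.1.residueCard : ℂ) ^ (-(2 * s)))) :
    ∏' v : {v : HeightOneSpectrum (𝓞 F) // v ∉ S}, I v =
      partialStandardL S (fun _ => {1}) (2 * s) /
        (partialStandardL S (fun _ => {1}) (2 * s + 1) * partialStandardL S (fun v => {ε.valueAtUniformizer v}) (2 * s + 2)) := by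
  rw [show I = fun v : {v : HeightOneSpectrum (𝓞 F) // v ∉ S} =>
      ((1 - (v.1.residueCard : ℂ) ^ (-(2 * s + 1))) * (1 - ε.valueAtUniformizer v.1 * (v.1.residueCard : ℂ) ^ (-(2 * s + 2)))) /
        (1 - (v.1.residueCard : ℂ) ^ (-(2 * s))) from funext hI]
  exact (hasProd_localScalarK1 (S := S) hε hs).tprod_eq

end GL1

/-! ## §2 The CM forms at the K2_Liu frame: `F = L⁺`, `ε = ε_{L∕L⁺}` -/

section CM

variable (L : Type) [Field L] [NumberField L] [IsCMField L]

/-- **THE K1 TAIL COLLAPSE AT THE K2_Liu FRAME** (`ε = ε_{L∕L⁺} =` ★ `quadraticHeckeCharCM L`, unitary since of finite order ★ `isFiniteOrder_quadraticHeckeCharCM`):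
`∏'_{v∉T} I v = [ζ_{L⁺}^T(2s) ∕ (ζ_{L⁺}^T(2s+1)·L^T(2s+2, ε_{L∕L⁺}))] · ∏_{v∈D} P v` for `I` pointwise `c¹_v(s)·P v`, `P = 1` off `T` outside the finite `D ⊆ Tᶜ`, `Re s > ½` —
exactly the `htail` scalar-and-factor shape of ★ `K2LiuRankOneSingularEulerContinued.exists_Eac_of_tail_scalarK1_cm`. [cite: Tan1999, §3; §4 Prop. 4.8] [cite: KudlaRallis1994, §2] -/
theorem tprod_eq_scalarK1_mul_finsetProd_of_forall_eq_cm (T : Set (HeightOneSpectrum (𝓞 ↥(maximalRealSubfield L)))) {s : ℂ} (hs : 1 / 2 < s.re)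
    (P : HeightOneSpectrum (𝓞 ↥(maximalRealSubfield L)) → ℂ) (D : Finset (HeightOneSpectrum (𝓞 ↥(maximalRealSubfield L))))
    (hDT : ∀ v ∈ D, v ∉ T) (hP : ∀ v, v ∉ T → v ∉ D → P v = 1)
    (I : {v : HeightOneSpectrum (𝓞 ↥(maximalRealSubfield L)) // v ∉ T} → ℂ)
    (hI : ∀ v : {v : HeightOneSpectrum (𝓞 ↥(maximalRealSubfield L)) // v ∉ T},
      I v = ((1 - (v.1.residueCard : ℂ) ^ (-(2 * s + 1))) *
              (1 - (quadraticHeckeCharCM L).valueAtUniformizer v.1 * (v.1.residueCard : ℂ) ^ (-(2 * s + 2)))) /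
            (1 - (v.1.residueCard : ℂ) ^ (-(2 * s))) * P v.1) :
    ∏' v : {v : HeightOneSpectrum (𝓞 ↥(maximalRealSubfield L)) // v ∉ T}, I v =
      partialStandardL T (fun _ => {1}) (2 * s) /
          (partialStandardL T (fun _ => {1}) (2 * s + 1) *
            partialStandardL T (fun v => {(quadraticHeckeCharCM L).valueAtUniformizer v}) (2 * s + 2)) *
        ∏ v ∈ D, P v :=
  tprod_eq_scalarK1_mul_finsetProd_of_forall_eq
    (Literature.RepresentationTheory.HarrisKudlaSweet1996.isFiniteOrder_quadraticHeckeCharCM (L := L)).isUnitary T hs P D hDT hP I hI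

/-- **THE K1 TAIL AT THE K2_Liu FRAME, NO FINITE FACTOR** (`Re s > ½`): `I v = c¹_v(s)` pointwise ⇒ `∏'_{v∉T} I v = ζ_{L⁺}^T(2s) ∕ (ζ_{L⁺}^T(2s+1)·L^T(2s+2, ε_{L∕L⁺}))`.
[cite: Tan1999, §4 Prop. 4.8] [cite: Harris2007, (1.3.4) p. 92] -/
theorem tprod_eq_scalarK1_of_forall_eq_cm (T : Set (HeightOneSpectrum (𝓞 ↥(maximalRealSubfield L)))) {s : ℂ} (hs : 1 / 2 < s.re)
    (I : {v : HeightOneSpectrum (𝓞 ↥(maximalRealSubfield L)) // v ∉ T} → ℂ)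
    (hI : ∀ v : {v : HeightOneSpectrum (𝓞 ↥(maximalRealSubfield L)) // v ∉ T},
      I v = ((1 - (v.1.residueCard : ℂ) ^ (-(2 * s + 1))) *
          (1 - (quadraticHeckeCharCM L).valueAtUniformizer v.1 * (v.1.residueCard : ℂ) ^ (-(2 * s + 2)))) /
        (1 - (v.1.residueCard : ℂ) ^ (-(2 * s)))) :
    ∏' v : {v : HeightOneSpectrum (𝓞 ↥(maximalRealSubfield L)) // v ∉ T}, I v =
      partialStandardL T (fun _ => {1}) (2 * s) /
        (partialStandardL T (fun _ => {1}) (2 * s + 1) *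
          partialStandardL T (fun v => {(quadraticHeckeCharCM L).valueAtUniformizer v}) (2 * s + 2)) :=
  tprod_eq_scalarK1_of_forall_eq
    (Literature.RepresentationTheory.HarrisKudlaSweet1996.isFiniteOrder_quadraticHeckeCharCM (L := L)).isUnitary T hs I hI

end CM

end Summit.HodgeConjecture.HodgeConjecture.Cruxes.HLiu418.K2LiuKindOneSingularTailCollapse

end
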